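import Literature.MathematicalPhysics.QuantumFieldTheory.VillainEnsembleProjection
import HarnessLib

/-!
# Locality and diagonal bounds for the full Laplacian `DDᵀ + EᵀE` of the Villain model on a cube

Support file for the Coulomb-gas (monopole) representation of four-dimensional `U(1)` lattice gauge
theory with the Villain action (proof programme of the named fact
`Literature.MathematicalPhysics.QuantumFieldTheory.FrohlichSpencerU1PerimeterLawD4` and of its
corollary `Literature.Barriers.QuantumFields.AbelianDeconfinementD4`). The renormalisation step of
Fröhlich–Spencer (§2.8, Corollary 4) integrates out, for every current density `ρ` of a 1-ensemble,
the Gaussian coordinates of a set `B_ρ ⊆ supp ρ` of cubes that are pairwise ORTHOGONAL for the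
precision `P = (4π²β)⁻¹(DDᵀ + EᵀE)` and gains a factor `exp(-ρ_b²/(2P_bb))` per cube. This file
supplies the two geometric inputs: the entries of `B' = DDᵀ + EᵀE` are LOCAL (`B'_{cc'} = 0` unless
`c = c'` or the base points are coordinatewise within distance one, i.e. `adjC c c'`), and the
DIAGONAL is bounded uniformly in the box (`0 < B'_{cc} ≤ Λ_d`):

* `DMat_apply`/`EMat_apply` (entries as images of basis vectors), `abs_DMat_le` (`≤ 6`),
  `abs_EMat_le` (`≤ 8`), `nearPt_of_DMat_ne_zero`, `nearPt_of_EMat_ne_zero`;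
* `card_filter_nearPt_plaq_le`, `card_filter_nearPt_fourCell_le` (crude counting by injections);
* `lapV_apply`, `lapV_apply_eq_zero_of_not_adjC`, `lapV_diag_pos`, `lamV`/`lapV_diag_le`.

Everything is proved; no named fact is introduced.

## References

* J. Fröhlich, T. Spencer, Comm. Math. Phys. 83 (1982) 411–454, §2.8 (2.59)–(2.64).
  [FrohlichSpencerCMP1982]
-/

noncomputable section

open Finset Function Matrix
open scoped Real
open Literature.Probability.LatticeModels
open Literature.Probability.LatticeModels.GaussianCoord (lap)

namespace Literature.MathematicalPhysics.QuantumFieldTheory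

namespace VillainAngle

open AxialGauge LatticeForm LatticeChain VillainFibre

variable {d n : ℕ}

/-! ### Entries of `D` and `E` -/

/-- `D_{cp} = (d δ_p)(c)`. [folklore] -/
theorem DMat_apply (c : CIdx d n) (p : PIdx d n) : DMat c p = fluxMapA (Pi.single p (1 : ℝ)) c := by
  rw [DMat, LinearMap.toMatrix'_apply]; rfl

/-- `E_{σc} = (d δ_c)(σ)`. [folklore] -/
theorem EMat_apply (σ : QIdx d n) (c : CIdx d n) : EMat σ c = cobd₃ (Pi.single c (1 : ℝ)) σ := by
  rw [EMat, LinearMap.toMatrix'_apply]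

/-- The extension of `δ_p` takes values in `{0, 1}` and is `δ` on labels. [folklore] -/
theorem extPlaqA_single (p : PIdx d n) (y : Literature.Probability.LatticeModels.Site d) (a b : Fin d) :
    extPlaqA (Pi.single p (1 : ℝ)) y a b = if p.1 = (y, a, b) then 1 else 0 := by
  unfold extPlaqA
  split_ifs with h h' h'
  · rw [Pi.single_apply, if_pos (Subtype.ext h'.symm)]
  · rw [Pi.single_apply, if_neg (fun heq => h' (congrArg Subtype.val heq).symm)]
  · exact absurd (h' ▸ p.2) h
  · rfl

/-- The extension of `δ_c` takes values in `{0, 1}` and is `δ` on labels. [folklore] -/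
theorem extCubeA_single (c : CIdx d n) (y : Literature.Probability.LatticeModels.Site d) (a b b' : Fin d) :
    extCubeA (Pi.single c (1 : ℝ)) y a b b' = if c.1 = (y, a, b, b') then 1 else 0 := by
  unfold extCubeA
  split_ifs with h h' h'
  · rw [Pi.single_apply, if_pos (Subtype.ext h'.symm)]
  · rw [Pi.single_apply, if_neg (fun heq => h' (congrArg Subtype.val heq).symm)]
  · exact absurd (h' ▸ c.2) h
  · rfl

/-- An indicator value has absolute value at most one. [folklore] -/
theorem abs_ite_le_one (P : Prop) [Decidable P] : |(if P then (1 : ℝ) else 0)| ≤ 1 := by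
  split_ifs <;> simp

/-- `|d₂ω| ≤ 6` when `|ω| ≤ 1`. [folklore] -/
theorem abs_d₂_le {ω : Literature.Probability.LatticeModels.Site d → Fin d → Fin d → ℝ} (hω : ∀ y a b, |ω y a b| ≤ 1)
    (x : Literature.Probability.LatticeModels.Site d) (i j k : Fin d) : |d₂ ω x i j k| ≤ 6 := by
  unfold d₂
  have h1 := abs_le.1 (hω (x + e i) j k); have h2 := abs_le.1 (hω x j k)
  have h3 := abs_le.1 (hω (x + e j) i k); have h4 := abs_le.1 (hω x i k)
  have h5 := abs_le.1 (hω (x + e k) i j); have h6 := abs_le.1 (hω x i j)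
  rw [abs_le]; constructor <;> linarith

/-- `|cd₃Q| ≤ 8` when `|Q| ≤ 1`. [folklore] -/
theorem abs_cd₃_le {Q : Literature.Probability.LatticeModels.Site d → Fin d → Fin d → Fin d → ℝ} (hQ : ∀ y a b c, |Q y a b c| ≤ 1)
    (x : Literature.Probability.LatticeModels.Site d) (i j k l : Fin d) : |cd₃ Q x i j k l| ≤ 8 := by
  unfold cd₃
  have h1 := abs_le.1 (hQ (x + e i) j k l); have h2 := abs_le.1 (hQ x j k l)
  have h3 := abs_le.1 (hQ (x + e j) i k l); have h4 := abs_le.1 (hQ x i k l)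
  have h5 := abs_le.1 (hQ (x + e k) i j l); have h6 := abs_le.1 (hQ x i j l)
  have h7 := abs_le.1 (hQ (x + e l) i j k); have h8 := abs_le.1 (hQ x i j k)
  rw [abs_le]; constructor <;> linarith

/-- `|D_{cp}| ≤ 6`. [folklore] -/
theorem abs_DMat_le (c : CIdx d n) (p : PIdx d n) : |DMat c p| ≤ 6 := by
  rw [DMat_apply, fluxMapA_apply]
  exact abs_d₂_le (fun y a b => by rw [extPlaqA_single]; exact abs_ite_le_one _) _ _ _ _

/-- `|E_{σc}| ≤ 8`. [folklore] -/
theorem abs_EMat_le (σ : QIdx d n) (c : CIdx d n) : |EMat σ c| ≤ 8 := by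
  rw [EMat_apply, cobd₃_apply]
  exact abs_cd₃_le (fun y a b b' => by rw [extCubeA_single]; exact abs_ite_le_one _) _ _ _ _ _

/-- **Locality of `D`**: `D_{cp} ≠ 0 ⇒` the base point of `p` is a corner above that of `c`. [folklore] -/
theorem nearPt_of_DMat_ne_zero {c : CIdx d n} {p : PIdx d n} (h : DMat c p ≠ 0) : NearPt c.1.1 p.1.1 := by
  rw [DMat_apply, fluxMapA_apply] at h
  simp only [d₂, extPlaqA_single] at h
  by_contra hfar
  have hz : ∀ (y : Literature.Probability.LatticeModels.Site d) (a b : Fin d), NearPt c.1.1 y →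
      (if p.1 = (y, a, b) then (1 : ℝ) else 0) = 0 := by
    intro y a b hy
    rw [if_neg]
    intro heq
    apply hfar
    have : p.1.1 = y := by rw [heq]
    rwa [this]
  rw [hz _ _ _ (nearPt_add_e _ _), hz _ _ _ (nearPt_self _), hz _ _ _ (nearPt_add_e _ _),
    hz _ _ _ (nearPt_self _), hz _ _ _ (nearPt_add_e _ _), hz _ _ _ (nearPt_self _)] at h
  exact h (by norm_num)

/-- **Locality of `E`**: `E_{σc} ≠ 0 ⇒` the base point of `c` is a corner above that of `σ`. [folklore] -/
theorem nearPt_of_EMat_ne_zero {σ : QIdx d n} {c : CIdx d n} (h : EMat σ c ≠ 0) : NearPt σ.1.1 c.1.1 := by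
  rw [EMat_apply, cobd₃_apply] at h
  simp only [cd₃, extCubeA_single] at h
  by_contra hfar
  have hz : ∀ (y : Literature.Probability.LatticeModels.Site d) (a b b' : Fin d), NearPt σ.1.1 y →
      (if c.1 = (y, a, b, b') then (1 : ℝ) else 0) = 0 := by
    intro y a b b' hy
    rw [if_neg]
    intro heq
    apply hfar
    have : c.1.1 = y := by rw [heq]
    rwa [this]
  rw [hz _ _ _ _ (nearPt_add_e _ _), hz _ _ _ _ (nearPt_self _), hz _ _ _ _ (nearPt_add_e _ _),
    hz _ _ _ _ (nearPt_self _), hz _ _ _ _ (nearPt_add_e _ _), hz _ _ _ _ (nearPt_self _),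
    hz _ _ _ _ (nearPt_add_e _ _), hz _ _ _ _ (nearPt_self _)] at h
  exact h (by norm_num)

/-- Two base points with a common corner above them are coordinatewise within distance one. [folklore] -/
theorem abs_sub_le_one_of_nearPt_common {x x' y : Literature.Probability.LatticeModels.Site d}
    (h : NearPt x y) (h' : NearPt x' y) (m : Fin d) : |x m - x' m| ≤ 1 := by
  rcases h m with h1 | h1 <;> rcases h' m with h2 | h2 <;> (rw [abs_le]; constructor <;> omega)

/-! ### Counting near cells -/

/-- At most `2^d d²` plaquettes of the box have their base point at a corner above `x`. [folklore] -/
theorem card_filter_nearPt_plaq_le (x : Literature.Probability.LatticeModels.Site d) [DecidablePred fun p : PIdx d n => NearPt x p.1.1] :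
    (Finset.univ.filter fun p : PIdx d n => NearPt x p.1.1).card ≤ 2 ^ d * (d * d) := by
  classical
  have hcard : (Finset.univ : Finset ((Fin d → Bool) × (Fin d × Fin d))).card = 2 ^ d * (d * d) := by
    rw [Finset.card_univ, Fintype.card_prod, Fintype.card_fun, Fintype.card_bool, Fintype.card_fin,
      Fintype.card_prod, Fintype.card_fin]
  rw [← hcard]
  refine Finset.card_le_card_of_injOn (fun p : PIdx d n => ((fun m => decide (p.1.1 m = x m + 1) : Fin d → Bool), p.1.2))
    (fun _ _ => Finset.mem_univ _) ?_
  intro p hp p' hp' hpp'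
  simp only [Finset.coe_filter, Finset.mem_univ, true_and, Set.mem_setOf_eq] at hp hp'
  obtain ⟨h1, h2⟩ := Prod.ext_iff.1 hpp'
  apply Subtype.ext
  refine Prod.ext (funext fun m => ?_) h2
  have hm : (p.1.1 m = x m + 1 ↔ p'.1.1 m = x m + 1) := by
    have := congrFun h1 m
    simpa using this
  rcases hp m with ha | ha <;> rcases hp' m with hb | hb <;> omega

/-- At most `2^d d⁴` 4-cells of the box have the given point as a corner above their base point. [folklore] -/
theorem card_filter_nearPt_fourCell_le (y : Literature.Probability.LatticeModels.Site d)
    [DecidablePred fun σ : QIdx d n => NearPt σ.1.1 y] :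
    (Finset.univ.filter fun σ : QIdx d n => NearPt σ.1.1 y).card ≤ 2 ^ d * (d * (d * (d * d))) := by
  classical
  have hcard : (Finset.univ : Finset ((Fin d → Bool) × (Fin d × Fin d × Fin d × Fin d))).card =
      2 ^ d * (d * (d * (d * d))) := by
    simp only [Finset.card_univ, Fintype.card_prod, Fintype.card_fun, Fintype.card_bool, Fintype.card_fin]
  rw [← hcard]
  refine Finset.card_le_card_of_injOn
    (fun σ : QIdx d n => ((fun m => decide (σ.1.1 m = y m - 1) : Fin d → Bool), σ.1.2))
    (fun _ _ => Finset.mem_univ _) ?_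
  intro σ hσ σ' hσ' hss'
  simp only [Finset.coe_filter, Finset.mem_univ, true_and, Set.mem_setOf_eq] at hσ hσ'
  obtain ⟨h1, h2⟩ := Prod.ext_iff.1 hss'
  apply Subtype.ext
  refine Prod.ext (funext fun m => ?_) h2
  have hm : (σ.1.1 m = y m - 1 ↔ σ'.1.1 m = y m - 1) := by
    have := congrFun h1 m
    simpa using this
  rcases hσ m with ha | ha <;> rcases hσ' m with hb | hb <;> omega

/-! ### Entries of the full Laplacian -/

/-- `B'_{cc'} = ∑_p D_{cp}D_{c'p} + ∑_σ E_{σc}E_{σc'}`. [folklore] -/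
theorem lapV_apply (c c' : CIdx d n) :
    lapV c c' = ∑ p, DMat c p * DMat c' p + ∑ σ, EMat σ c * EMat σ c' := by
  rw [lapV, lap, Matrix.add_apply, Matrix.mul_apply, Matrix.mul_apply]
  simp only [Matrix.transpose_apply]

/-- **Locality of `B'`**: `B'_{cc'} = 0` unless `c = c'` or `adjC c c'`. [cite: FrohlichSpencerCMP1982, §2.8 (2.59)–(2.60)] -/
theorem lapV_apply_eq_zero_of_not_adjC {c c' : CIdx d n} (hne : c ≠ c') (hfar : ¬ adjC c c') : lapV c c' = 0 := by
  rw [lapV_apply]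
  have hD : ∀ p, DMat c p * DMat c' p = 0 := by
    intro p
    by_contra h
    obtain ⟨h1, h2⟩ := mul_ne_zero_iff.1 h
    exact hfar ⟨hne, fun m => abs_sub_le_one_of_nearPt_common (nearPt_of_DMat_ne_zero h1)
      (nearPt_of_DMat_ne_zero h2) m⟩
  have hE : ∀ σ, EMat σ c * EMat σ c' = 0 := by
    intro σ
    by_contra h
    obtain ⟨h1, h2⟩ := mul_ne_zero_iff.1 h
    exact hfar ⟨hne, fun m => abs_sub_le_one_of_nearPt (nearPt_of_EMat_ne_zero h1) (nearPt_of_EMat_ne_zero h2) m⟩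
  simp [hD, hE]

/-- **The diagonal of `B'` is positive.** [folklore] -/
theorem lapV_diag_pos (c : CIdx d n) : 0 < lapV c c := by
  exact (posDef_lapV (d := d) (n := n)).diag_pos

variable (d) in
/-- A uniform bound for the diagonal of `B'`. [folklore] -/
def lamV : ℝ := 36 * (2 ^ d * (d * d)) + 64 * (2 ^ d * (d * (d * (d * d))))

/-- `Λ_d > 0`-free form: `Λ_d ≥ 0`. [folklore] -/
theorem lamV_nonneg : 0 ≤ lamV d := by unfold lamV; positivity

/-- **The diagonal of `B'` is bounded uniformly in the box**: `B'_{cc} ≤ Λ_d`. [cite: FrohlichSpencerCMP1982, §2.8 (2.64)] -/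
theorem lapV_diag_le (c : CIdx d n) : lapV c c ≤ lamV d := by
  classical
  rw [lapV_apply, lamV]
  refine add_le_add ?_ ?_
  · -- plaquette part
    have hsub : ∑ p, DMat c p * DMat c p = ∑ p ∈ Finset.univ.filter (fun p : PIdx d n => NearPt c.1.1 p.1.1),
        DMat c p * DMat c p := by
      rw [Finset.sum_filter]
      refine Finset.sum_congr rfl fun p _ => ?_
      split_ifs with h
      · rfl
      · have : DMat c p = 0 := by by_contra hne; exact h (nearPt_of_DMat_ne_zero hne)
        rw [this, mul_zero]
    rw [hsub]
    calc _ ≤ ∑ p ∈ Finset.univ.filter (fun p : PIdx d n => NearPt c.1.1 p.1.1), (36 : ℝ) := by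
          refine Finset.sum_le_sum fun p _ => ?_
          have h6 := abs_DMat_le c p
          nlinarith [abs_nonneg (DMat c p), sq_abs (DMat c p)]
      _ = 36 * ((Finset.univ.filter (fun p : PIdx d n => NearPt c.1.1 p.1.1)).card : ℝ) := by
          rw [Finset.sum_const, nsmul_eq_mul, mul_comm]
      _ ≤ 36 * (2 ^ d * (d * d) : ℝ) := by
          gcongr
          exact_mod_cast card_filter_nearPt_plaq_le (n := n) c.1.1
  · -- 4-cell part
    have hsub : ∑ σ, EMat σ c * EMat σ c = ∑ σ ∈ Finset.univ.filter (fun σ : QIdx d n => NearPt σ.1.1 c.1.1),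
        EMat σ c * EMat σ c := by
      rw [Finset.sum_filter]
      refine Finset.sum_congr rfl fun σ _ => ?_
      split_ifs with h
      · rfl
      · have : EMat σ c = 0 := by by_contra hne; exact h (nearPt_of_EMat_ne_zero hne)
        rw [this, mul_zero]
    rw [hsub]
    calc _ ≤ ∑ σ ∈ Finset.univ.filter (fun σ : QIdx d n => NearPt σ.1.1 c.1.1), (64 : ℝ) := by
          refine Finset.sum_le_sum fun σ _ => ?_
          have h8 := abs_EMat_le σ c
          nlinarith [abs_nonneg (EMat σ c), sq_abs (EMat σ c)]
      _ = 64 * ((Finset.univ.filter (fun σ : QIdx d n => NearPt σ.1.1 c.1.1)).card : ℝ) := by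
          rw [Finset.sum_const, nsmul_eq_mul, mul_comm]
      _ ≤ 64 * (2 ^ d * (d * (d * (d * d))) : ℝ) := by
          gcongr
          exact_mod_cast card_filter_nearPt_fourCell_le (n := n) c.1.1

end VillainAngle

end Literature.MathematicalPhysics.QuantumFieldTheory
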